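import Literature.MathematicalPhysics.QuantumManyBody.LiebYngvasonTheorem
import HarnessLib

/-!
# No binding from classical stability, I: the Neumann cell (Lee 2009, Lemma 9)

Topic `Literature/MathematicalPhysics/QuantumManyBody`, on top of the Lieb–Yngvason Neumann-cell
layer (`LiebYngvasonLowerBound.lean`, `LiebYngvasonCellMethod.lean`, `LiebYngvasonPoincare.lean`).
J. O. Lee [Lee2009, Thm. 7 and Lemma 9] proves that a pair potential `V₁ - δV₂` with `V₁ ≥ 0` of
positive core (`V₁(0) > 0`), `V₂ ≥ 0` of finite range and `V₁ - V₂` classically stable, binds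
nothing in a Neumann cube of side `O(1)` once `δ` is small. We formalise the two ingredients of
Lemma 9 as inequalities between `ℝ≥0∞`-valued quadratic forms on `C¹` functions of the open cube
`Λ_ℓ^n = boxN n ℓ` (never a signed potential: "`δ·(V₂-form) ≤ (V₁-form)`"):

* `exists_two_body_floor` — **the two-body floor** `E(2, Λ_ℓ, v) ≥ e > 0`, uniformly for
  `ℓ ∈ [ℓ₁, 2ℓ₁]`, for a measurable `v ≥ 0` with a positive core `v ≥ w > 0` on `[0, r₁)`.
  Lee uses Dyson's lemma; we use instead the Neumann gap of the cube (`neumannPoincare_boxN`,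
  the sharp Poincaré–Wirtinger inequality `(π²/ℓ²)∫|ψ - ⟨ψ⟩|² ≤ ∫|∇ψ|²`): on the sub-cube
  `Λ_{r₁/2}^2` the two particles are within the core, so `∫ v|ψ|² ≥ w ∫_{Λ_{r₁/2}^2} |ψ|²`, while
  `|ψ|²` is comparable to `|⟨ψ⟩|²` up to the fluctuation controlled by the gap; the constant is
  explicit (`e = min (π²/16ℓ₁²) (θ w (r₁/2)⁶ / 256ℓ₁⁶)`, `θ = min 1 (π²/(8ℓ₁²w))`).
* `cube_domination` — **Lee's Lemma 9 as a form inequality**: if `e ≤ E(2, Λ_ℓ, v)` and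
  `t ∑_{i<j} W ≤ ∑_{i<j} v + B·n` pointwise on every `n`-point configuration (classical
  stability of `v - tW` with constant `B`), then for `δ = min ½ (e/6B)` and every `C¹` `φ` on
  `Λ_ℓ^n`, `δt ∫ (∑W)|φ|² ≤ ∫ (|∇φ|² + (∑v)|φ|²)`: superadditivity
  `E(n) ≥ ⌊n/2⌋ E(2) ≥ (n/3) e` (`LSSY2005_superadditivity_holds`), the variational principle
  for the unnormalised `φ` (`neumannGroundStateEnergy_mul_normSq_le`) and the interpolation
  `δ(Bn) ≤ (1-δ)⌊n/2⌋e`.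

## References

* [Lee2009] J. O. Lee, *Ground state energy of dilute Bose gas in small negative potential
  case*, J. Stat. Phys. 134 (2009) 1–18, arXiv:0803.0533: Thm. 7, Lemma 9 (pp. 5–6).
* [LSSY2005] E. H. Lieb, R. Seiringer, J. P. Solovej, J. Yngvason, *The Mathematics of the Bose
  Gas and its Condensation* (2005): (2.52)–(2.53) and the Neumann gap after (2.50).
-/

noncomputable section

open MeasureTheory Filter Metric
open scoped ENNReal NNReal

namespace Literature.MathematicalPhysics.QuantumManyBody.BoseGas

/-! ### Elementary inequalities -/

/-- `‖a‖² ≤ 2‖b‖² + 2‖a - b‖²` in `ℝ≥0∞` (parallelogram-type bound from the triangle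
inequality). [folklore] -/
theorem ennnorm_sq_le_two_mul_add (a b : ℂ) :
    (‖a‖₊ : ℝ≥0∞) ^ 2 ≤ 2 * (‖b‖₊ : ℝ≥0∞) ^ 2 + 2 * (‖a - b‖₊ : ℝ≥0∞) ^ 2 := by
  have h : (‖a‖₊ : ℝ≥0) ^ 2 ≤ 2 * ‖b‖₊ ^ 2 + 2 * ‖a - b‖₊ ^ 2 := by
    rw [← NNReal.coe_le_coe]
    push_cast
    have h1 : 0 ≤ ‖b‖ + ‖a - b‖ - ‖a‖ := by linarith [norm_sub_norm_le a b]
    nlinarith [mul_nonneg (norm_nonneg a) h1,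
      mul_nonneg h1 (add_nonneg (norm_nonneg b) (norm_nonneg (a - b))),
      sq_nonneg (‖b‖ - ‖a - b‖)]
  have h' := ENNReal.coe_le_coe.2 h
  push_cast at h'
  exact h'

/-- `‖b‖² ≤ 2‖a‖² + 2‖a - b‖²` in `ℝ≥0∞`. [folklore] -/
theorem ennnorm_sq_le_two_mul_add' (a b : ℂ) :
    (‖b‖₊ : ℝ≥0∞) ^ 2 ≤ 2 * (‖a‖₊ : ℝ≥0∞) ^ 2 + 2 * (‖a - b‖₊ : ℝ≥0∞) ^ 2 := by
  have h := ennnorm_sq_le_two_mul_add b a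
  rwa [← nnnorm_neg (b - a), neg_sub] at h

/-- The interaction of two particles is the single pair term. [folklore] -/
theorem interaction_two (v : ℝ → ℝ≥0∞) (X : Config 2) :
    interaction v X = v (dist (X 0) (X 1)) := by
  simp [interaction, Fin.sum_univ_two, Finset.sum_filter]

/-- With at most one particle there are no pairs: the interaction vanishes. [folklore] -/
theorem interaction_eq_zero_of_le_one {n : ℕ} (hn : n ≤ 1) (W : ℝ → ℝ≥0∞) (X : Config n) :
    interaction W X = 0 := by
  unfold interaction
  refine Finset.sum_eq_zero fun i _ => Finset.sum_eq_zero fun j hj => ?_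
  exfalso
  have hij := (Finset.mem_filter.1 hj).2
  rw [Fin.lt_def] at hij
  have := j.2
  omega

/-- Two points of the open cube `Λ_s` are at distance `< 2s` (indeed `< √3 s`). [folklore] -/
theorem dist_lt_two_mul_of_mem_box {s : ℝ} {x y : Space} (hx : x ∈ box s) (hy : y ∈ box s) :
    dist x y < 2 * s := by
  have hs : 0 < s := (hx 0).1.trans (hx 0).2
  rw [EuclideanSpace.dist_eq, Real.sqrt_lt' (by positivity)]
  have hk : ∀ k, dist (x k) (y k) ^ 2 < s ^ 2 := fun k => by
    rw [Real.dist_eq, sq_abs]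
    exact sq_lt_sq' (by linarith [(hx k).1, (hy k).2]) (by linarith [(hx k).2, (hy k).1])
  calc ∑ k, dist (x k) (y k) ^ 2 < ∑ _k : Fin 3, s ^ 2 :=
        Finset.sum_lt_sum_of_nonempty Finset.univ_nonempty fun k _ => hk k
    _ = 3 * s ^ 2 := by simp
    _ ≤ (2 * s) ^ 2 := by nlinarith

/-! ### The two-body floor from the Neumann gap -/

/-- **Two-body floor in a Neumann cube.** Let `v ≥ 0` be measurable with a positive core,
`v(r) ≥ w > 0` for `0 ≤ r < r₁`, and `r₁/2 ≤ ℓ₁`. There is an explicit `e > 0` such that for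
every cube side `ℓ ∈ [ℓ₁, 2ℓ₁]` and every `C¹` function `ψ` of two particles,
`e ∫_{Λ_ℓ^2} |ψ|² ≤ ∫_{Λ_ℓ^2} (|∇ψ|² + v(|x₁-x₂|)|ψ|²)`; in particular `E(2, Λ_ℓ, v) ≥ e`.
This is the statement `E(2, S, V₁) ≥ E' > 0` of Lee's Lemma 9 (for cubes), proved here with the
Neumann gap `π²/ℓ²` of the cube in place of Dyson's lemma: writing `c = ⟨ψ⟩`,
`(π²/ℓ²)∫|ψ-c|² ≤ ∫|∇ψ|²`, `∫v|ψ|² ≥ w∫_{Λ_{r₁/2}^2}|ψ|²` (both particles in `Λ_{r₁/2}` are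
within `r₁`), `|c|²|Λ_{r₁/2}^2| ≤ 2∫_{Λ_{r₁/2}^2}(|ψ|² + |ψ-c|²)` and
`∫|ψ|² ≤ 2|c|²ℓ⁶ + 2∫|ψ-c|²`. [cite: Lee2009, Lemma 9] -/
theorem exists_two_body_floor {v : ℝ → ℝ≥0∞} {w r₁ ℓ₁ : ℝ} (hw : 0 < w)
    (hr₁ : 0 < r₁) (hcore : ∀ r, 0 ≤ r → r < r₁ → ENNReal.ofReal w ≤ v r) (hℓ₁ : r₁ / 2 ≤ ℓ₁) :
    ∃ e : ℝ, 0 < e ∧ ∀ ℓ : ℝ, ℓ₁ ≤ ℓ → ℓ ≤ 2 * ℓ₁ → ∀ ψ : Config 2 → ℂ, ContDiff ℝ 1 ψ →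
      ENNReal.ofReal e * ∫⁻ X in boxN 2 ℓ, (‖ψ X‖₊ : ℝ≥0∞) ^ 2 ≤
        ∫⁻ X in boxN 2 ℓ, kineticDensity ψ X + interaction v X * (‖ψ X‖₊ : ℝ≥0∞) ^ 2 := by
  have hℓ₁pos : 0 < ℓ₁ := lt_of_lt_of_le (by positivity) hℓ₁
  set s := r₁ / 2 with hs_def
  have hs : 0 < s := by positivity
  set θ := min 1 (Real.pi ^ 2 / (8 * ℓ₁ ^ 2 * w)) with hθ_def
  have hθpos : 0 < θ := lt_min one_pos (by positivity)
  have hθ1 : θ ≤ 1 := min_le_left _ _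
  have hθ2 : θ * w ≤ Real.pi ^ 2 / (8 * ℓ₁ ^ 2) := by
    calc θ * w ≤ Real.pi ^ 2 / (8 * ℓ₁ ^ 2 * w) * w :=
          mul_le_mul_of_nonneg_right (min_le_right _ _) hw.le
      _ = Real.pi ^ 2 / (8 * ℓ₁ ^ 2) := by field_simp
  set e := min (Real.pi ^ 2 / (16 * ℓ₁ ^ 2)) (θ * w * s ^ 6 / (256 * ℓ₁ ^ 6)) with he_def
  refine ⟨e, lt_min (by positivity) (by positivity), fun ℓ hℓ hℓ2 ψ hψ => ?_⟩
  have hℓpos : 0 < ℓ := hℓ₁pos.trans_le hℓ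
  have hsℓ : s ≤ ℓ := hℓ₁.trans hℓ
  -- the constants
  have he1 : 2 * e ≤ Real.pi ^ 2 / (2 * ℓ ^ 2) := by
    have h := min_le_left (Real.pi ^ 2 / (16 * ℓ₁ ^ 2)) (θ * w * s ^ 6 / (256 * ℓ₁ ^ 6))
    have hℓsq : ℓ ^ 2 ≤ 4 * ℓ₁ ^ 2 := by nlinarith
    calc 2 * e ≤ 2 * (Real.pi ^ 2 / (16 * ℓ₁ ^ 2)) := by linarith
      _ = Real.pi ^ 2 / (2 * (4 * ℓ₁ ^ 2)) := by ring
      _ ≤ Real.pi ^ 2 / (2 * ℓ ^ 2) := by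
          apply div_le_div_of_nonneg_left (by positivity) (by positivity)
          linarith
  have he2 : 2 * e * ℓ ^ 6 ≤ θ * w / 2 * s ^ 6 := by
    have h := min_le_right (Real.pi ^ 2 / (16 * ℓ₁ ^ 2)) (θ * w * s ^ 6 / (256 * ℓ₁ ^ 6))
    have hℓ6 : ℓ ^ 6 ≤ 64 * ℓ₁ ^ 6 := by
      have : ℓ ^ 6 ≤ (2 * ℓ₁) ^ 6 := pow_le_pow_left₀ hℓpos.le hℓ2 6
      nlinarith
    have hθw : 0 ≤ θ * w * s ^ 6 := by positivity
    calc 2 * e * ℓ ^ 6 ≤ 2 * (θ * w * s ^ 6 / (256 * ℓ₁ ^ 6)) * (64 * ℓ₁ ^ 6) := by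
          apply mul_le_mul (by linarith) hℓ6 (by positivity)
          have : 0 ≤ θ * w * s ^ 6 / (256 * ℓ₁ ^ 6) := by positivity
          linarith
      _ = θ * w / 2 * s ^ 6 := by field_simp; norm_num
  have hθ3 : θ * w + Real.pi ^ 2 / (2 * ℓ ^ 2) ≤ Real.pi ^ 2 / ℓ ^ 2 := by
    have hℓsq : ℓ ^ 2 ≤ 4 * ℓ₁ ^ 2 := by nlinarith
    have : Real.pi ^ 2 / (8 * ℓ₁ ^ 2) ≤ Real.pi ^ 2 / (2 * ℓ ^ 2) := by
      apply div_le_div_of_nonneg_left (by positivity) (by positivity)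
      linarith
    have h2 : Real.pi ^ 2 / (2 * ℓ ^ 2) + Real.pi ^ 2 / (2 * ℓ ^ 2) = Real.pi ^ 2 / ℓ ^ 2 := by
      field_simp; ring
    linarith
  have hθ4 : θ * w ≤ w := by nlinarith
  -- abbreviations
  set c : ℂ := ⨍ Y in boxN 2 ℓ, ψ Y with hc_def
  set m := ∫⁻ X in boxN 2 ℓ, (‖ψ X‖₊ : ℝ≥0∞) ^ 2 with hm_def
  set F := ∫⁻ X in boxN 2 ℓ, (‖ψ X - c‖₊ : ℝ≥0∞) ^ 2 with hF_def
  set T := ∫⁻ X in boxN 2 ℓ, kineticDensity ψ X with hT_def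
  set V := ∫⁻ X in boxN 2 ℓ, interaction v X * (‖ψ X‖₊ : ℝ≥0∞) ^ 2 with hV_def
  set mA := ∫⁻ X in boxN 2 s, (‖ψ X‖₊ : ℝ≥0∞) ^ 2 with hmA_def
  set FA := ∫⁻ X in boxN 2 s, (‖ψ X - c‖₊ : ℝ≥0∞) ^ 2 with hFA_def
  have hsub : boxN 2 s ⊆ boxN 2 ℓ := fun X hX i k => ⟨(hX i k).1, (hX i k).2.trans_le hsℓ⟩
  have hn2 : Measurable fun X : Config 2 => (‖ψ X‖₊ : ℝ≥0∞) ^ 2 :=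
    measurable_normSq hψ.continuous
  have hn2c : Measurable fun X : Config 2 => (‖ψ X - c‖₊ : ℝ≥0∞) ^ 2 :=
    measurable_normSq (hψ.continuous.sub continuous_const)
  -- the Neumann gap
  have hP : ENNReal.ofReal (Real.pi ^ 2 / ℓ ^ 2) * F ≤ T :=
    neumannPoincare_boxN_holds 2 ℓ hℓpos ψ hψ
  -- the core on the small cube
  have hVA : ENNReal.ofReal w * mA ≤ V := by
    calc ENNReal.ofReal w * mA
        = ∫⁻ X in boxN 2 s, ENNReal.ofReal w * (‖ψ X‖₊ : ℝ≥0∞) ^ 2 :=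
          (lintegral_const_mul _ hn2).symm
      _ ≤ ∫⁻ X in boxN 2 s, interaction v X * (‖ψ X‖₊ : ℝ≥0∞) ^ 2 := by
          refine setLIntegral_mono' (measurableSet_boxN 2 s) fun X hX => ?_
          gcongr
          rw [interaction_two]
          refine hcore _ dist_nonneg ?_
          have h := dist_lt_two_mul_of_mem_box (hX 0) (hX 1)
          rw [hs_def] at h
          linarith
      _ ≤ V := lintegral_mono_set hsub
  -- the mean on the small cube
  have h3 : (‖c‖₊ : ℝ≥0∞) ^ 2 * volume (boxN 2 s) ≤ 2 * mA + 2 * F := by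
    calc (‖c‖₊ : ℝ≥0∞) ^ 2 * volume (boxN 2 s)
        = ∫⁻ _X in boxN 2 s, (‖c‖₊ : ℝ≥0∞) ^ 2 := (setLIntegral_const _ _).symm
      _ ≤ ∫⁻ X in boxN 2 s, 2 * (‖ψ X‖₊ : ℝ≥0∞) ^ 2 + 2 * (‖ψ X - c‖₊ : ℝ≥0∞) ^ 2 :=
          lintegral_mono fun X => ennnorm_sq_le_two_mul_add' (ψ X) c
      _ = 2 * mA + 2 * FA := by
          rw [lintegral_add_left (hn2.const_mul 2), lintegral_const_mul _ hn2,
            lintegral_const_mul _ hn2c]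
      _ ≤ 2 * mA + 2 * F := by
          gcongr
          exact lintegral_mono_set hsub
  -- the mass of the big cube
  have h4 : m ≤ 2 * ((‖c‖₊ : ℝ≥0∞) ^ 2 * volume (boxN 2 ℓ)) + 2 * F := by
    calc m ≤ ∫⁻ X in boxN 2 ℓ, 2 * (‖c‖₊ : ℝ≥0∞) ^ 2 + 2 * (‖ψ X - c‖₊ : ℝ≥0∞) ^ 2 :=
          lintegral_mono fun X => ennnorm_sq_le_two_mul_add (ψ X) c
      _ = 2 * ((‖c‖₊ : ℝ≥0∞) ^ 2 * volume (boxN 2 ℓ)) + 2 * F := by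
          rw [lintegral_add_left (measurable_const.const_mul 2), lintegral_const_mul _ hn2c,
            lintegral_const_mul _ measurable_const, setLIntegral_const]
  -- volumes
  have hvolA : volume (boxN 2 s) = ENNReal.ofReal (s ^ 6) := by
    rw [volume_boxN, ← pow_mul, ENNReal.ofReal_pow hs.le]
  have hvolB : volume (boxN 2 ℓ) = ENNReal.ofReal (ℓ ^ 6) := by
    rw [volume_boxN, ← pow_mul, ENNReal.ofReal_pow hℓpos.le]
  have hepos : 0 ≤ e := (lt_min (by positivity) (by positivity) : (0:ℝ) < e).le
  -- assembly
  calc ENNReal.ofReal e * m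
      ≤ ENNReal.ofReal e * (2 * ((‖c‖₊ : ℝ≥0∞) ^ 2 * volume (boxN 2 ℓ)) + 2 * F) := by gcongr
    _ = ENNReal.ofReal (2 * e * ℓ ^ 6) * (‖c‖₊ : ℝ≥0∞) ^ 2 + ENNReal.ofReal (2 * e) * F := by
        rw [hvolB, show (2 : ℝ) * e * ℓ ^ 6 = (2 * e) * ℓ ^ 6 by ring,
          ENNReal.ofReal_mul (by positivity : (0:ℝ) ≤ 2 * e),
          ENNReal.ofReal_mul (by norm_num : (0:ℝ) ≤ 2), ENNReal.ofReal_ofNat]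
        ring
    _ ≤ ENNReal.ofReal (θ * w / 2 * s ^ 6) * (‖c‖₊ : ℝ≥0∞) ^ 2 +
          ENNReal.ofReal (Real.pi ^ 2 / (2 * ℓ ^ 2)) * F := by
        gcongr
    _ = ENNReal.ofReal (θ * w / 2) * ((‖c‖₊ : ℝ≥0∞) ^ 2 * volume (boxN 2 s)) +
          ENNReal.ofReal (Real.pi ^ 2 / (2 * ℓ ^ 2)) * F := by
        rw [hvolA, ENNReal.ofReal_mul (by positivity : (0:ℝ) ≤ θ * w / 2)]
        ring
    _ ≤ ENNReal.ofReal (θ * w / 2) * (2 * mA + 2 * F) +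
          ENNReal.ofReal (Real.pi ^ 2 / (2 * ℓ ^ 2)) * F := by gcongr
    _ = ENNReal.ofReal (θ * w) * mA +
          (ENNReal.ofReal (θ * w) + ENNReal.ofReal (Real.pi ^ 2 / (2 * ℓ ^ 2))) * F := by
        have h2 : ENNReal.ofReal (θ * w / 2) * 2 = ENNReal.ofReal (θ * w) := by
          rw [← ENNReal.ofReal_ofNat 2, ← ENNReal.ofReal_mul (by positivity)]
          congr 1
          ring
        calc ENNReal.ofReal (θ * w / 2) * (2 * mA + 2 * F) +
              ENNReal.ofReal (Real.pi ^ 2 / (2 * ℓ ^ 2)) * F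
            = ENNReal.ofReal (θ * w / 2) * 2 * mA + (ENNReal.ofReal (θ * w / 2) * 2 +
                ENNReal.ofReal (Real.pi ^ 2 / (2 * ℓ ^ 2))) * F := by ring
          _ = _ := by rw [h2]
    _ ≤ ENNReal.ofReal w * mA + ENNReal.ofReal (Real.pi ^ 2 / ℓ ^ 2) * F := by
        gcongr ?_ * mA + ?_ * F
        · exact ENNReal.ofReal_le_ofReal hθ4
        · rw [← ENNReal.ofReal_add (by positivity) (by positivity)]
          exact ENNReal.ofReal_le_ofReal hθ3
    _ ≤ V + T := add_le_add hVA hP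
    _ = T + V := add_comm _ _
    _ = _ := (lintegral_add_left (measurable_kineticDensity hψ) _).symm

/-- The two-body floor as a bound on the Neumann ground-state energy:
`e ≤ E(2, Λ_ℓ, v)` for `ℓ ∈ [ℓ₁, 2ℓ₁]`. [cite: Lee2009, Lemma 9] -/
theorem exists_le_neumannGroundStateEnergy_two {v : ℝ → ℝ≥0∞} {w r₁ ℓ₁ : ℝ} (hw : 0 < w)
    (hr₁ : 0 < r₁) (hcore : ∀ r, 0 ≤ r → r < r₁ → ENNReal.ofReal w ≤ v r) (hℓ₁ : r₁ / 2 ≤ ℓ₁) :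
    ∃ e : ℝ, 0 < e ∧ ∀ ℓ : ℝ, ℓ₁ ≤ ℓ → ℓ ≤ 2 * ℓ₁ →
      ENNReal.ofReal e ≤ neumannGroundStateEnergy v 2 ℓ := by
  obtain ⟨e, he, h⟩ := exists_two_body_floor hw hr₁ hcore hℓ₁
  refine ⟨e, he, fun ℓ hℓ hℓ2 => le_iInf fun Ψ => ?_⟩
  have := h ℓ hℓ hℓ2 Ψ.ψ Ψ.contDiff
  rwa [Ψ.norm_eq, mul_one] at this

/-! ### Lee's Lemma 9: domination in a cube from stability and the floor -/

/-- **Lee's Lemma 9 (form version).** Let `v, W ≥ 0` be measurable pair profiles, `ℓ > 0`, and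
suppose (i) the two-body floor `e ≤ E(2, Λ_ℓ, v)` with `e > 0`, and (ii) classical stability
of `v - tW` with constant `B > 0`: `t ∑_{i<j} W(|xᵢ-xⱼ|) ≤ ∑_{i<j} v(|xᵢ-xⱼ|) + Bn` for every
configuration of every number `n` of points. Then with `δ = min ½ (e/6B)`, for every `n` and
every `C¹` function `φ` on `Λ_ℓ^n`,
`δt ∫_{Λ^n} (∑W)|φ|² ≤ ∫_{Λ^n} (|∇φ|² + (∑v)|φ|²)`, i.e. `H(v - δtW) ≥ 0` on the Neumann cube
uniformly in `n`. Proof as printed: integrate stability against `|φ|²`, bound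
`E(n)∫|φ|² ≤ ∫(|∇φ|² + ∑v|φ|²)` with `E(n) ≥ ⌊n/2⌋E(2) ≥ ⌊n/2⌋e` (superadditivity (2.53)),
and interpolate: `δBn ≤ (1-δ)⌊n/2⌋e` as `⌊n/2⌋ ≥ n/3` for `n ≥ 2`. [cite: Lee2009, Lemma 9] -/
theorem cube_domination {v W : ℝ → ℝ≥0∞} (hv : Measurable v) {ℓ e t B : ℝ} (hℓ : 0 < ℓ)
    (he : 0 < e) (hB : 0 < B)
    (hfloor : ENNReal.ofReal e ≤ neumannGroundStateEnergy v 2 ℓ)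
    (hstab : ∀ (n : ℕ) (X : Config n),
      ENNReal.ofReal t * interaction W X ≤ interaction v X + ENNReal.ofReal (B * n))
    (n : ℕ) (φ : Config n → ℂ) (hφ : ContDiff ℝ 1 φ) :
    ENNReal.ofReal (min (1 / 2) (e / (6 * B)) * t) *
        ∫⁻ X in boxN n ℓ, interaction W X * (‖φ X‖₊ : ℝ≥0∞) ^ 2 ≤
      ∫⁻ X in boxN n ℓ, kineticDensity φ X + interaction v X * (‖φ X‖₊ : ℝ≥0∞) ^ 2 := by
  set δ := min (1 / 2) (e / (6 * B)) with hδ_def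
  have hδpos : 0 < δ := lt_min (by norm_num) (by positivity)
  have hδhalf : δ ≤ 1 / 2 := min_le_left _ _
  have hδe : δ ≤ e / (6 * B) := min_le_right _ _
  rcases Nat.lt_or_ge n 2 with hn | hn
  · -- no pairs
    have h0 : ∀ X : Config n, interaction W X = 0 := fun X =>
      interaction_eq_zero_of_le_one (by omega) W X
    simp [h0]
  set m := ∫⁻ X in boxN n ℓ, (‖φ X‖₊ : ℝ≥0∞) ^ 2 with hm_def
  set T := ∫⁻ X in boxN n ℓ, kineticDensity φ X with hT_def
  set V := ∫⁻ X in boxN n ℓ, interaction v X * (‖φ X‖₊ : ℝ≥0∞) ^ 2 with hV_def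
  set Wi := ∫⁻ X in boxN n ℓ, interaction W X * (‖φ X‖₊ : ℝ≥0∞) ^ 2 with hWi_def
  have hn2 : Measurable fun X : Config n => (‖φ X‖₊ : ℝ≥0∞) ^ 2 :=
    measurable_normSq hφ.continuous
  have hTV : (∫⁻ X in boxN n ℓ, kineticDensity φ X + interaction v X * (‖φ X‖₊ : ℝ≥0∞) ^ 2)
      = T + V := lintegral_add_left (measurable_kineticDensity hφ) _
  -- stability, integrated against `|φ|²`
  have h1 : ENNReal.ofReal t * Wi ≤ V + ENNReal.ofReal (B * n) * m := by
    calc ENNReal.ofReal t * Wi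
        = ∫⁻ X in boxN n ℓ, ENNReal.ofReal t * (interaction W X * (‖φ X‖₊ : ℝ≥0∞) ^ 2) :=
          (lintegral_const_mul' _ _ ENNReal.ofReal_ne_top).symm
      _ ≤ ∫⁻ X in boxN n ℓ, interaction v X * (‖φ X‖₊ : ℝ≥0∞) ^ 2 +
            ENNReal.ofReal (B * n) * (‖φ X‖₊ : ℝ≥0∞) ^ 2 := by
          refine lintegral_mono fun X => ?_
          rw [← mul_assoc, ← add_mul]
          exact mul_le_mul_left (hstab n X) _
      _ = V + ENNReal.ofReal (B * n) * m := by
          rw [lintegral_add_right _ (hn2.const_mul _), lintegral_const_mul _ hn2]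
  -- the floor `⌊n/2⌋ e ∫|φ|² ≤ E(n) ∫|φ|² ≤ T + V`
  have h2 : ENNReal.ofReal ((n / 2 : ℕ) * e) * m ≤ T + V := by
    have hE : ((n / 2 : ℕ) : ℝ≥0∞) * ENNReal.ofReal e ≤ neumannGroundStateEnergy v n ℓ := by
      have h := LSSY2005_superadditivity_holds.mul_le hv hℓ 2 (n / 2) (n % 2)
      rw [Nat.div_add_mod' n 2] at h
      exact le_trans (mul_le_mul_right hfloor _) h
    calc ENNReal.ofReal ((n / 2 : ℕ) * e) * m
        = ((n / 2 : ℕ) : ℝ≥0∞) * ENNReal.ofReal e * m := by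
          rw [ENNReal.ofReal_mul (Nat.cast_nonneg _), ENNReal.ofReal_natCast]
      _ ≤ neumannGroundStateEnergy v n ℓ * m := mul_le_mul_left hE _
      _ ≤ _ := neumannGroundStateEnergy_mul_normSq_le v hφ
      _ = T + V := hTV
  -- interpolation of the constants
  have hkey : δ * (B * n) ≤ (1 - δ) * ((n / 2 : ℕ) * e) := by
    have hn3 : (n : ℝ) ≤ 3 * ((n / 2 : ℕ) : ℝ) := by
      have : n ≤ 3 * (n / 2) := by omega
      exact_mod_cast this
    have hδB : δ * B ≤ e / 6 := by
      calc δ * B ≤ e / (6 * B) * B := mul_le_mul_of_nonneg_right hδe hB.le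
        _ = e / 6 := by field_simp
    calc δ * (B * n) = (δ * B) * n := by ring
      _ ≤ (e / 6) * n := mul_le_mul_of_nonneg_right hδB (Nat.cast_nonneg n)
      _ ≤ (e / 6) * (3 * ((n / 2 : ℕ) : ℝ)) := mul_le_mul_of_nonneg_left hn3 (by positivity)
      _ = (1 / 2) * ((n / 2 : ℕ) * e) := by ring
      _ ≤ (1 - δ) * ((n / 2 : ℕ) * e) :=
          mul_le_mul_of_nonneg_right (by linarith) (by positivity)
  -- assembly
  calc ENNReal.ofReal (δ * t) * Wi = ENNReal.ofReal δ * (ENNReal.ofReal t * Wi) := by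
        rw [ENNReal.ofReal_mul hδpos.le, mul_assoc]
    _ ≤ ENNReal.ofReal δ * (V + ENNReal.ofReal (B * n) * m) := mul_le_mul_right h1 _
    _ = ENNReal.ofReal δ * V + ENNReal.ofReal (δ * (B * n)) * m := by
        rw [mul_add, ENNReal.ofReal_mul hδpos.le, mul_assoc]
    _ ≤ ENNReal.ofReal δ * (T + V) + ENNReal.ofReal ((1 - δ) * ((n / 2 : ℕ) * e)) * m :=
        add_le_add (mul_le_mul_right le_add_self _)
          (mul_le_mul_left (ENNReal.ofReal_le_ofReal hkey) _)
    _ = ENNReal.ofReal δ * (T + V) +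
          ENNReal.ofReal (1 - δ) * (ENNReal.ofReal ((n / 2 : ℕ) * e) * m) := by
        rw [ENNReal.ofReal_mul (by linarith), mul_assoc]
    _ ≤ ENNReal.ofReal δ * (T + V) + ENNReal.ofReal (1 - δ) * (T + V) := by gcongr
    _ = T + V := by
        rw [← add_mul, ← ENNReal.ofReal_add hδpos.le (by linarith), add_sub_cancel,
          ENNReal.ofReal_one, one_mul]
    _ = _ := hTV.symm

end Literature.MathematicalPhysics.QuantumManyBody.BoseGas

end
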